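/-
COR-CM (cell pub-hodgecm2, stage 2 of the Hodge ladder) — count-neutral KERNEL COMBINATORICS «field level of the BINARY TETRAHEDRAL law: every Galois CM
field of degree 24 — hence of degree 8p for EVERY odd prime p — has EXACTLY φ₂(F) generating faces, no hypothesis on the group» (seat
prover-pub-hodgecm2-b23-g53-0, binder prover b23, gen 53; claim HOME/INBOX.md l.24246, NAME ASK l.24300 — stem `CorCM/FaceBinaryTetrahedral*`, lead ACK
l.24306).  Theorems only; `Census/BinaryTetrahedralLaw.lean` (this seat), the field transfer `CorCM/FaceGenerationTransfer.lean` and the INT2-GEN socket are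
used BY NAME; nothing asserted.  `Interfaces.lean` (C1), every E term, B01, `Transposition/*`, `PortJoin/*`, `D2Bridge/*` untouched.
HONEST FRAMING: `HC_CM` is NOT proved, here or anywhere in the tree; this file produces no period and proves no face period for any field; §2 is CONDITIONAL
on the face periods exactly as the earlier sockets.
T5: n/a-class (hypothesis binders: `[F:ℚ] = 24` — inhabited by every Galois CM field of degree 24, e.g. `ℚ(ζ₇, √−1)·k₃`-type composita and
`SL(2,3)`-fields; resp. `[F:ℚ] = 8p`; checker: self, 2026-08-25).
-/
import Summits.HodgeConjecture.CorCM.Census.BinaryTetrahedralLaw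
import Summits.HodgeConjecture.CorCM.FaceSylowTransferEightPrimeAll
import HarnessLib

/-!
# Field level of the binary tetrahedral law: every Galois CM field of degree `24`, every Galois CM field of degree `8p`

**`isLeast_card_faces_hgen_of_finrank_eq_twentyfour`**: a Galois CM field `F` of degree `24` (Galois group ANY of the fifteen groups of order `24`,
complex conjugation ANY central involution — including the `SL(2,3)`-fields with conjugation `−1`) has EXACTLY `φ₂(F)` generating faces — `σ₀` and the
degree only (`Census/BinaryTetrahedralLaw`: the order-`24` dichotomy and the binary tetrahedral law `μ(SL(2,3), −1) = φ₂ = β − 2`).  Hence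
**`isLeast_card_faces_hgen_of_finrank_eq_eight_mul_odd_prime`** for EVERY odd prime `p`, and **every Galois CM field of degree `< 64` other than `16`,
`32`, `48`** (`isLeast_card_faces_hgen_of_finrank_lt_sixtyFour'`).  Block currency for an `SL(2,3)` datum in the Galois translates: EXACTLY `β(F) − 2`
faces (`isLeast_card_faces_hgen_of_binaryTetrahedral`).  §2: the CONDITIONAL Hodge-conjecture readings through the INT2-GEN socket.  `HC_CM` is NOT proved.

## References
* [Pohlmann1968] H. Pohlmann, Algebraic cycles on abelian varieties of complex multiplication type, Ann. of Math. 88 (1968), Thm 1.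
* [Shimura1998] G. Shimura, Abelian Varieties with Complex Multiplication and Modular Functions, §6.2 Thm. 3, §8.1.
-/

noncomputable section

open CategoryTheory NumberField NumberField.ComplexEmbedding
open Literature.AlgebraicGeometry Literature.AlgebraicGeometry.Motives Literature.AlgebraicGeometry.HodgeTheory
open Literature.AlgebraicGeometry.ComplexMultiplication Literature.AlgebraicGeometry.Milne1999
open Literature.NumberTheory.Automorphic
open Literature.NumberTheory.Automorphic.PicardCM
open Summit.HodgeConjecture.CorCM.Domination

namespace Summit.HodgeConjecture.CorCM.FaceBinaryTetrahedral

open Summit.HodgeConjecture.CorCM.Prior.AllgGroup.RfwfAllgGroup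
open Summit.HodgeConjecture.CorCM.Census.BlockParity
open Summit.HodgeConjecture.CorCM.Census.Coinvariant
open Summit.HodgeConjecture.CorCM.Census

section Field

variable {F : Type} [Field F] [NumberField F]

/-! ## §1 Exactly `φ₂(F)` generating faces -/

/-- **EVERY GALOIS CM FIELD OF DEGREE `24` HAS EXACTLY `φ₂(F)` GENERATING FACES** — no hypothesis on the Galois group or on complex conjugation
(the fifteen groups of order `24`, including the `SL(2,3)`-fields). [folklore] -/
theorem isLeast_card_faces_hgen_of_finrank_eq_twentyfour [IsCMField F] [IsGalois ℚ F] (hdeg : Module.finrank ℚ F = 24) (σ₀ : F →+* ℂ) :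
    IsLeast {n : ℕ | ∃ 𝒮 : Finset (Face F), 𝒮.card = n ∧
      ∀ f : Face F, lefChar f.corner (fun _ => ({σ₀} : Finset (F →+* ℂ))) ∈ AddSubgroup.closure
        {a : Asym F | ∃ g ∈ (𝒮 : Set (Face F)), ∃ σ : F →+* ℂ, a = lefChar g.corner (fun _ => ({σ} : Finset (F →+* ℂ)))}}
      (fibreTwo (conjT : GalT F) conjT_mul_self) := by
  refine FaceTransfer.isLeast_card_faces_hgen_of_intrinsic _ ?_ (fun S₀ hS₀ hS => ?_) σ₀
  · obtain ⟨S, hS, hcard, hgen⟩ := (BinaryTetrahedral.isLeast_card_gfaces_generate_fibreTwo_of_card_eq_twentyfour conjT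
      ((FaceCensus.card_galT (F := F)).trans hdeg) conjT_mul_self conjT_ne_one FaceBasis.conjT_comm).1
    exact ⟨S, hS, hcard.le, hgen⟩
  · exact fibreTwo_le_card conjT conjT_mul_self FaceBasis.conjT_comm S₀ (Submodule.span ℤ (pairSet conjT)) le_rfl hS₀
      (fun y hy => hS (gfaceSet_subset_hodgeSpan conjT conjT_mul_self hy))

/-- **EVERY GALOIS CM FIELD OF DEGREE `8p`, `p` ANY ODD PRIME, HAS EXACTLY `φ₂(F)` GENERATING FACES** — no hypothesis on the Galois group
(the order-`8p` census is complete). [folklore] -/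
theorem isLeast_card_faces_hgen_of_finrank_eq_eight_mul_odd_prime [IsCMField F] [IsGalois ℚ F] {p : ℕ} (hp : p.Prime) (hp2 : p ≠ 2)
    (hdeg : Module.finrank ℚ F = 8 * p) (σ₀ : F →+* ℂ) :
    IsLeast {n : ℕ | ∃ 𝒮 : Finset (Face F), 𝒮.card = n ∧
      ∀ f : Face F, lefChar f.corner (fun _ => ({σ₀} : Finset (F →+* ℂ))) ∈ AddSubgroup.closure
        {a : Asym F | ∃ g ∈ (𝒮 : Set (Face F)), ∃ σ : F →+* ℂ, a = lefChar g.corner (fun _ => ({σ} : Finset (F →+* ℂ)))}}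
      (fibreTwo (conjT : GalT F) conjT_mul_self) := by
  refine FaceTransfer.isLeast_card_faces_hgen_of_intrinsic _ ?_ (fun S₀ hS₀ hS => ?_) σ₀
  · obtain ⟨S, hS, hcard, hgen⟩ := (BinaryTetrahedral.isLeast_card_gfaces_generate_fibreTwo_of_card_eq_eight_mul_prime conjT hp hp2
      ((FaceCensus.card_galT (F := F)).trans hdeg) conjT_mul_self conjT_ne_one FaceBasis.conjT_comm).1
    exact ⟨S, hS, hcard.le, hgen⟩
  · exact fibreTwo_le_card conjT conjT_mul_self FaceBasis.conjT_comm S₀ (Submodule.span ℤ (pairSet conjT)) le_rfl hS₀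
      (fun y hy => hS (gfaceSet_subset_hodgeSpan conjT conjT_mul_self hy))

/-- **EVERY GALOIS CM FIELD OF DEGREE `< 64` OTHER THAN `16, 32, 48` HAS EXACTLY `φ₂(F)` GENERATING FACES** — the Sylow-transfer laneʼs
`isLeast_card_faces_hgen_of_finrank_lt_sixtyFour` with the row `24` supplied by the binary tetrahedral law; NO hypothesis on the Galois group. [folklore] -/
theorem isLeast_card_faces_hgen_of_finrank_lt_sixtyFour' [IsCMField F] [IsGalois ℚ F] (h64 : Module.finrank ℚ F < 64)
    (h16 : Module.finrank ℚ F ≠ 16) (h32 : Module.finrank ℚ F ≠ 32) (h48 : Module.finrank ℚ F ≠ 48) (σ₀ : F →+* ℂ) :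
    IsLeast {n : ℕ | ∃ 𝒮 : Finset (Face F), 𝒮.card = n ∧
      ∀ f : Face F, lefChar f.corner (fun _ => ({σ₀} : Finset (F →+* ℂ))) ∈ AddSubgroup.closure
        {a : Asym F | ∃ g ∈ (𝒮 : Set (Face F)), ∃ σ : F →+* ℂ, a = lefChar g.corner (fun _ => ({σ} : Finset (F →+* ℂ)))}}
      (fibreTwo (conjT : GalT F) conjT_mul_self) := by
  by_cases h24 : Module.finrank ℚ F = 24
  · exact isLeast_card_faces_hgen_of_finrank_eq_twentyfour h24 σ₀
  · exact FaceSylowTransfer.isLeast_card_faces_hgen_of_finrank_lt_sixtyFour h64 h16 h24 h32 h48 σ₀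

/-- **A BINARY TETRAHEDRAL DATUM IN THE GALOIS TRANSLATES ⟹ EXACTLY `β(F) − 2` GENERATING FACES** (`Gal(F/ℚ) ≅ SL(2,3)`, conjugation `−1`; block
currency of the law). [folklore] -/
theorem isLeast_card_faces_hgen_of_binaryTetrahedral [IsCMField F] [IsGalois ℚ F] (D : BinaryTetrahedral.Datum (GalT F) conjT) (σ₀ : F →+* ℂ) :
    IsLeast {n : ℕ | ∃ 𝒮 : Finset (Face F), 𝒮.card = n ∧
      ∀ f : Face F, lefChar f.corner (fun _ => ({σ₀} : Finset (F →+* ℂ))) ∈ AddSubgroup.closure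
        {a : Asym F | ∃ g ∈ (𝒮 : Set (Face F)), ∃ σ : F →+* ℂ, a = lefChar g.corner (fun _ => ({σ} : Finset (F →+* ℂ)))}}
      (Fintype.card (Block (conjT : GalT F)) - 2) := by
  have h := D.card_block_eq_fibreTwo_add_two
  have e : Fintype.card (Block (conjT : GalT F)) - 2 = fibreTwo (conjT : GalT F) conjT_mul_self := by omega
  rw [e]
  refine FaceTransfer.isLeast_card_faces_hgen_of_intrinsic _ ?_ (fun S₀ hS₀ hS => ?_) σ₀
  · obtain ⟨S, hS, hcard, hgen⟩ := (BinaryTetrahedral.isLeast_card_gfaces_generate_fibreTwo D).1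
    exact ⟨S, hS, hcard.le, hgen⟩
  · exact fibreTwo_le_card conjT conjT_mul_self FaceBasis.conjT_comm S₀ (Submodule.span ℤ (pairSet conjT)) le_rfl hS₀
      (fun y hy => hS (gfaceSet_subset_hodgeSpan conjT conjT_mul_self hy))

/-- **THE ROW `SL(2,3)` AT THE FIELD LEVEL: EXACTLY `174` GENERATING FACES** for a Galois CM field of degree `24` whose Galois translates carry a
binary tetrahedral datum (`Gal ≅ SL(2,3)`, conjugation `−1`; `β(F) = 176`). [folklore] -/
theorem isLeast_card_faces_hgen_oneHundredSeventyFour [IsCMField F] [IsGalois ℚ F] (D : BinaryTetrahedral.Datum (GalT F) conjT) (σ₀ : F →+* ℂ) :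
    IsLeast {n : ℕ | ∃ 𝒮 : Finset (Face F), 𝒮.card = n ∧
      ∀ f : Face F, lefChar f.corner (fun _ => ({σ₀} : Finset (F →+* ℂ))) ∈ AddSubgroup.closure
        {a : Asym F | ∃ g ∈ (𝒮 : Set (Face F)), ∃ σ : F →+* ℂ, a = lefChar g.corner (fun _ => ({σ} : Finset (F →+* ℂ)))}} 174 := by
  have h := isLeast_card_faces_hgen_of_binaryTetrahedral D σ₀
  rwa [D.card_block_eq_oneHundredSeventySix] at h

end Field

/-! ## §2 The conditional Hodge-conjecture readings -/

/-- **HC for the slice of a Galois CM field of degree `24`, from `φ₂(K)` face periods** (CONDITIONAL; `HC_CM` is NOT proved).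
[cite: Shimura1998, §6.2 Theorem 3 and §6.1 Corollary of Theorem 2 (pp. 41–43)] [cite: Pohlmann1968, Thm. 1]
[cite: Milne1999LefschetzClasses, Thm. 3.2 and Cor. 4.5] [cite: MumfordAV1970, §19 Thm. 1 and p. 169] -/
theorem hodgeConjectureFor_of_finrank_eq_twentyfour_of_exists_facePeriod (K : CMField) [hGal : IsGalois ℚ K] (σ₀ : (K : Type) →+* ℂ)
    (hdeg : Module.finrank ℚ K = 24) :
    ∃ 𝒮 : Finset (Face K), 𝒮.card = fibreTwo (conjT : GalT K) conjT_mul_self ∧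
      ((∀ f ∈ 𝒮, ∃ ι₁ : K →+* ℂ, f.Admissible ι₁ ∧ ∃ (V : HermSpace3 K ι₁) (σ : K →+* ℂ),
        (Model.picardCMUniverse exists_isReal_hodgeModel_holds hodgePQ_independent_of_hodgeModel_holds
          BallQuotient.ballQuotientUniformised_holds cmAbelianVarietyRealised_holds).PeriodNV ι₁ V K f.psi σ) →
      ∀ {P B : AbelianVariety ℂ}, AbelianVariety.IsProductOf (fun B : AbelianVariety ℂ =>
        ∃ (E : Type) (_ : Field E) (_ : NumberField E) (_ : IsCMField E) (_ : E →+* (K : Type)) (Φ : CMType E)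
          (ι : 𝓞 E →+* End B) (ϑ : E →+* Module.End ℂ (complexBetti B.X 1)),
          IsCMTypeRealisation Φ B ι ϑ) P →
      AVDominatedBy B P → HodgeConjectureFor B.dim B.X) := by
  obtain ⟨⟨𝒮, hcard, hgen⟩, -⟩ := isLeast_card_faces_hgen_of_finrank_eq_twentyfour (F := K) hdeg σ₀
  refine ⟨𝒮, hcard, fun h P B hP hB => ?_⟩
  have h6 : 6 ≤ Module.finrank ℚ K := by rw [hdeg]; omega
  exact hodgeConjectureFor_of_avDominatedBy_isProductOf_of_exists_facePeriod_on K h6 (𝒮 : Set (Face K)) σ₀ hgen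
    (fun f hf => h f (Finset.mem_coe.mp hf)) hP hB

/-- **HC for the slice of a Galois CM field of degree `8p` (`p` any odd prime), from `φ₂(K)` face periods** (CONDITIONAL; `HC_CM` is NOT proved).
[cite: Shimura1998, §6.2 Theorem 3 and §6.1 Corollary of Theorem 2 (pp. 41–43)] [cite: Pohlmann1968, Thm. 1]
[cite: Milne1999LefschetzClasses, Thm. 3.2 and Cor. 4.5] [cite: MumfordAV1970, §19 Thm. 1 and p. 169] -/
theorem hodgeConjectureFor_of_finrank_eq_eight_mul_odd_prime_of_exists_facePeriod (K : CMField) [hGal : IsGalois ℚ K] (σ₀ : (K : Type) →+* ℂ)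
    {p : ℕ} (hp : p.Prime) (hp2 : p ≠ 2) (hdeg : Module.finrank ℚ K = 8 * p) :
    ∃ 𝒮 : Finset (Face K), 𝒮.card = fibreTwo (conjT : GalT K) conjT_mul_self ∧
      ((∀ f ∈ 𝒮, ∃ ι₁ : K →+* ℂ, f.Admissible ι₁ ∧ ∃ (V : HermSpace3 K ι₁) (σ : K →+* ℂ),
        (Model.picardCMUniverse exists_isReal_hodgeModel_holds hodgePQ_independent_of_hodgeModel_holds
          BallQuotient.ballQuotientUniformised_holds cmAbelianVarietyRealised_holds).PeriodNV ι₁ V K f.psi σ) →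
      ∀ {P B : AbelianVariety ℂ}, AbelianVariety.IsProductOf (fun B : AbelianVariety ℂ =>
        ∃ (E : Type) (_ : Field E) (_ : NumberField E) (_ : IsCMField E) (_ : E →+* (K : Type)) (Φ : CMType E)
          (ι : 𝓞 E →+* End B) (ϑ : E →+* Module.End ℂ (complexBetti B.X 1)),
          IsCMTypeRealisation Φ B ι ϑ) P →
      AVDominatedBy B P → HodgeConjectureFor B.dim B.X) := by
  obtain ⟨⟨𝒮, hcard, hgen⟩, -⟩ := isLeast_card_faces_hgen_of_finrank_eq_eight_mul_odd_prime (F := K) hp hp2 hdeg σ₀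
  refine ⟨𝒮, hcard, fun h P B hP hB => ?_⟩
  have h6 : 6 ≤ Module.finrank ℚ K := by rw [hdeg]; have := hp.two_le; omega
  exact hodgeConjectureFor_of_avDominatedBy_isProductOf_of_exists_facePeriod_on K h6 (𝒮 : Set (Face K)) σ₀ hgen
    (fun f hf => h f (Finset.mem_coe.mp hf)) hP hB

end Summit.HodgeConjecture.CorCM.FaceBinaryTetrahedral
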